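import Summits.SmoothPoincare4.SmoothPoincare4.Theorems.SymplecticOrigamiGromovRecognitionRelEndStubCapModelAux3

/-!
# Positive holonomy for `GromovRecognitionRelEnd` — linear algebra in the axis plane
(stub `stub_positiveHolonomy` of line `cross-cap-laurent`, crux `SymplecticOrigami.GromovRecognitionRelEnd`,
item stmt-SmoothPoincare4-11009; first auxiliary file, pure linear algebra on `ℝ⁴ = ℂ²`)

The retraction `λ_V` of the wedge cap onto the sphere `H∞` reads, in a cap chart `η` of `H∞`, as
`η ∘ ℓ` with `ℓ` valued in the axis plane `A = {p₂ = p₃ = 0} = ℂ × 0`; its differential at a point is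
`dη ∘ ℓ'` with `ℓ' : ℝ⁴ → A` linear.  This file is the linear algebra of such an `ℓ'` together with a
linear complex structure `J` (`J² = -1`) of `ℝ⁴` leaving `ker ℓ'` invariant:

* `plane_decomp`: in `A`, `a' = α a + β I4 a` with `α = ⟨a, a'⟩ / |a|²`, `β = dx₀∧dx₁ (a, a') / |a|²`;
* `coeff_unique`: the coefficients on `(w, J w)` are unique (`J` has no real eigenvector);
* `ar01_ne_zero`: the **holonomy form** `D(v) = dx₀∧dx₁ (ℓ' v, ℓ' (J v))` does not vanish off `ker ℓ'`;
* `ar01_pos_iff`: its sign does not depend on `v` (`D (x v₀ + y J v₀ + k) = (x² + y²) D(v₀)`);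
* `exists_ne_zero_map_eq_zero`: `ℓ'` is not injective (`dim A = 2 < 4`);
* `exists_swap`: the coordinate swap `(z₁, z₂) ↦ (z₂, z₁)` as a continuous linear automorphism
  commuting with `I4` (used to transport everything from `H∞` to `V∞`).

Everything is proved; no definition, no named fact.
-/

noncomputable section

-- the registered namespace `Summit.SmoothPoincare4.SmoothPoincare4.Theorems…` repeats a component
set_option linter.dupNamespace false

open Set Function

namespace Summit.SmoothPoincare4.SmoothPoincare4.Theorems.GromovRecognitionRelEnd.CrossCapLaurent

namespace PosHolonomy

open CapModel

/-! ## Decomposition in the axis plane `A = {p₂ = p₃ = 0}` -/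

/-- A non-zero vector of the axis plane has `|z₁|² ≠ 0`. [folklore] -/
theorem r1_ne_zero_of_plane {a : EuclideanSpace ℝ (Fin 4)} (ha2 : a 2 = 0) (ha3 : a 3 = 0)
    (ha : a ≠ 0) : r1 a ≠ 0 := by
  intro h
  obtain ⟨h0, h1⟩ := (r1_eq_zero_iff a).1 h
  apply ha
  ext i
  fin_cases i <;> simp [h0, h1, ha2, ha3]

/-- **Decomposition in the axis plane.** For `a ≠ 0` and `a'` in `A = {p₂ = p₃ = 0}`:
`a' = α a + β I4 a` with `α = (a₀a'₀ + a₁a'₁) / |a|²`, `β = (a₀a'₁ - a₁a'₀) / |a|²`. [folklore] -/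
theorem plane_decomp {a a' : EuclideanSpace ℝ (Fin 4)} (ha2 : a 2 = 0) (ha3 : a 3 = 0)
    (ha'2 : a' 2 = 0) (ha'3 : a' 3 = 0) (ha : a ≠ 0) :
    a' = ((a 0 * a' 0 + a 1 * a' 1) / r1 a) • a + (ar01 a a' / r1 a) • I4 a := by
  have hr : r1 a ≠ 0 := r1_ne_zero_of_plane ha2 ha3 ha
  ext i
  fin_cases i
  · simp only [Fin.zero_eta, Fin.isValue, PiLp.add_apply, PiLp.smul_apply, smul_eq_mul, I4_apply0]
    rw [r1_def] at hr ⊢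
    field_simp
    rw [ar01_def]
    ring
  · simp only [Fin.mk_one, Fin.isValue, PiLp.add_apply, PiLp.smul_apply, smul_eq_mul, I4_apply1]
    rw [r1_def] at hr ⊢
    field_simp
    rw [ar01_def]
    ring
  · simp [ha2, ha3, ha'2]
  · simp [ha2, ha3, ha'3]

/-- **Uniqueness of the coefficients on `(w, J w)`** for a linear `J` with `J² = -1` and `w ≠ 0`
(a complex structure has no real eigenvector). [folklore] -/
theorem coeff_unique {V : Type*} [AddCommGroup V] [Module ℝ V] (J : V →ₗ[ℝ] V)
    (hJ : ∀ v, J (J v) = -v) {w : V} (hw : w ≠ 0) {α β α' β' : ℝ}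
    (h : α • w + β • J w = α' • w + β' • J w) : α = α' ∧ β = β' := by
  have h1 : (α - α') • w = (β' - β) • J w := by
    rw [sub_smul, sub_smul]
    have : α • w - α' • w - ((β' • J w) - β • J w) = 0 := by
      rw [show α • w - α' • w - (β' • J w - β • J w) = (α • w + β • J w) - (α' • w + β' • J w) by abel,
        h, sub_self]
    exact sub_eq_zero.1 this
  by_cases hb : β = β'
  · refine ⟨?_, hb⟩
    rw [hb, sub_self, zero_smul] at h1
    have h2 : α - α' = 0 := by
      by_contra hne
      exact hw ((smul_eq_zero.1 h1).resolve_left hne)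
    linarith
  · exfalso
    have hne : β' - β ≠ 0 := sub_ne_zero.2 (Ne.symm hb)
    set t : ℝ := (α - α') / (β' - β) with ht
    have h2 : J w = t • w := by
      have := congrArg (fun v => (β' - β)⁻¹ • v) h1
      simp only [smul_smul, inv_mul_cancel₀ hne, one_smul] at this
      rw [← this, ht, div_eq_inv_mul]
    have h3 : J (J w) = (t * t) • w := by
      rw [h2, LinearMap.map_smul, h2, smul_smul]
    rw [hJ] at h3
    have h4 : (t * t + 1) • w = 0 := by
      rw [add_smul, one_smul, ← h3, neg_add_cancel]
    have h5 : t * t + 1 ≠ 0 := by nlinarith [mul_self_nonneg t]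
    exact hw ((smul_eq_zero.1 h4).resolve_left h5)

/-! ## The holonomy form `D(v) = dx₀∧dx₁ (ℓ' v, ℓ' (J v))` -/

section Form

variable {L J : EuclideanSpace ℝ (Fin 4) →L[ℝ] EuclideanSpace ℝ (Fin 4)}

/-- **The holonomy form does not vanish off the kernel.** If `ℓ'` is valued in the axis plane,
`J² = -1` and `ker ℓ'` is `J`-invariant, then `dx₀∧dx₁ (ℓ' v, ℓ' (J v)) ≠ 0` whenever `ℓ' v ≠ 0`
(otherwise `ℓ' (J v) = α ℓ' v`, and applying `J` once more gives `-(1 + α²) ℓ' v = 0`). [folklore] -/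
theorem ar01_ne_zero (hJ : ∀ v, J (J v) = -v) (hL : ∀ v, L v 2 = 0 ∧ L v 3 = 0)
    (hker : ∀ v, L v = 0 → L (J v) = 0) {v : EuclideanSpace ℝ (Fin 4)} (hv : L v ≠ 0) :
    ar01 (L v) (L (J v)) ≠ 0 := by
  intro hD
  set α : ℝ := (L v 0 * L (J v) 0 + L v 1 * L (J v) 1) / r1 (L v) with hα
  have hdec := plane_decomp (hL v).1 (hL v).2 (hL (J v)).1 (hL (J v)).2 hv
  rw [hD, zero_div, zero_smul, add_zero, ← hα] at hdec
  -- `ℓ' (J v - α v) = 0`, hence `ℓ' (J (J v - α v)) = 0`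
  have h1 : L (J v - α • v) = 0 := by
    rw [map_sub, map_smul, hdec, sub_self]
  have h2 := hker _ h1
  rw [map_sub, map_smul, hJ, map_sub, map_neg, map_smul, hdec, smul_smul] at h2
  have h3 : (-(1 + α * α)) • L v = 0 := by
    rw [neg_smul, add_smul, one_smul, neg_add]
    rwa [sub_eq_add_neg] at h2
  have h4 : -(1 + α * α) ≠ 0 := by nlinarith [mul_self_nonneg α]
  exact hv ((smul_eq_zero.1 h3).resolve_left h4)

/-- **The sign of the holonomy form does not depend on the vector.** With `a = ℓ' v₀ ≠ 0`,
`a' = ℓ' (J v₀)`, every `ℓ' v` is `x a + y a'`, `v - x v₀ - y J v₀ ∈ ker ℓ'`, and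
`D(v) = dx₀∧dx₁ (x a + y a', x a' - y a) = (x² + y²) D(v₀)`. [folklore] -/
theorem ar01_pos_iff (hJ : ∀ v, J (J v) = -v) (hL : ∀ v, L v 2 = 0 ∧ L v 3 = 0)
    (hker : ∀ v, L v = 0 → L (J v) = 0) {v₀ v : EuclideanSpace ℝ (Fin 4)} (hv₀ : L v₀ ≠ 0)
    (hv : L v ≠ 0) : (0 < ar01 (L v) (L (J v)) ↔ 0 < ar01 (L v₀) (L (J v₀))) := by
  set a := L v₀ with ha
  set a' := L (J v₀) with ha'
  set b := L v with hb
  set d := ar01 a a' with hd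
  have hd0 : d ≠ 0 := ar01_ne_zero hJ hL hker hv₀
  set x : ℝ := ar01 b a' / d with hx
  set y : ℝ := ar01 a b / d with hy
  -- Cramer in the plane: `b = x a + y a'`
  have hbxy : b = x • a + y • a' := by
    have hd' : d = a 0 * a' 1 - a 1 * a' 0 := by rw [hd, ar01_def]
    ext i
    fin_cases i
    · simp only [Fin.zero_eta, Fin.isValue, PiLp.add_apply, PiLp.smul_apply, smul_eq_mul]
      rw [hx, hy, ar01_def, ar01_def]
      field_simp
      rw [hd']
      ring
    · simp only [Fin.mk_one, Fin.isValue, PiLp.add_apply, PiLp.smul_apply, smul_eq_mul]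
      rw [hx, hy, ar01_def, ar01_def]
      field_simp
      rw [hd']
      ring
    · simp only [Fin.reduceFinMk, Fin.isValue, PiLp.add_apply, PiLp.smul_apply, smul_eq_mul]
      rw [hb, ha, ha', (hL v).1, (hL v₀).1, (hL (J v₀)).1]; ring
    · simp only [Fin.reduceFinMk, Fin.isValue, PiLp.add_apply, PiLp.smul_apply, smul_eq_mul]
      rw [hb, ha, ha', (hL v).2, (hL v₀).2, (hL (J v₀)).2]; ring
  -- the kernel element `k = v - x v₀ - y J v₀`
  have hk : L (v - x • v₀ - y • J v₀) = 0 := by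
    rw [map_sub, map_sub, map_smul, map_smul, ← hb, ← ha, ← ha', hbxy]; abel
  have hJk := hker _ hk
  have hLJv : L (J v) = x • a' - y • a := by
    rw [map_sub, map_sub, map_smul, map_smul, hJ, map_sub, map_sub, map_smul, map_smul, map_neg,
      ← ha, ← ha'] at hJk
    have : L (J v) - x • a' - y • -a = 0 := hJk
    rw [smul_neg, sub_neg_eq_add] at this
    have := sub_eq_zero.1 (show (L (J v)) - (x • a' - y • a) = 0 by rw [← this]; abel)
    exact this
  -- `D(v) = (x² + y²) d`
  have hDv : ar01 (L v) (L (J v)) = (x ^ 2 + y ^ 2) * d := by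
    rw [← hb, hLJv, hbxy, hd, ar01_def, ar01_def]
    simp only [PiLp.add_apply, PiLp.sub_apply, PiLp.smul_apply, smul_eq_mul]
    ring
  have hxy : 0 < x ^ 2 + y ^ 2 := by
    rcases lt_or_eq_of_le (add_nonneg (sq_nonneg x) (sq_nonneg y)) with h | h
    · exact h
    · exfalso
      have hx0 : x = 0 := by nlinarith [sq_nonneg x, sq_nonneg y]
      have hy0 : y = 0 := by nlinarith [sq_nonneg x, sq_nonneg y]
      apply hv
      rw [hbxy, hx0, hy0, zero_smul, zero_smul, add_zero]
  rw [hDv]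
  exact mul_pos_iff_of_pos_left hxy

/-- **A linear map valued in the axis plane is not injective** (`dim A = 2 < 4 = dim ℝ⁴`): some
non-zero vector is mapped to `0`. [folklore] -/
theorem exists_ne_zero_map_eq_zero (hL : ∀ v, L v 2 = 0 ∧ L v 3 = 0) :
    ∃ v : EuclideanSpace ℝ (Fin 4), v ≠ 0 ∧ L v = 0 := by
  by_contra h
  push Not at h
  -- `v ↦ (ℓ' v 0, ℓ' v 1)` would be an injective linear map `ℝ⁴ → ℝ²`
  set f : EuclideanSpace ℝ (Fin 4) →L[ℝ] ℝ × ℝ := ((pr 0).prod (pr 1)).comp L with hf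
  have hinj : Function.Injective f.toLinearMap := by
    intro v w hvw
    have h0 : L v 0 = L w 0 := congrArg Prod.fst hvw
    have h1 : L v 1 = L w 1 := congrArg Prod.snd hvw
    have hL' : L v = L w := by
      ext i
      fin_cases i
      · exact h0
      · exact h1
      · simp only [Fin.reduceFinMk, Fin.isValue]; rw [(hL v).1, (hL w).1]
      · simp only [Fin.reduceFinMk, Fin.isValue]; rw [(hL v).2, (hL w).2]
    by_contra hne
    have := h (v - w) (sub_ne_zero.2 hne)
    rw [map_sub, hL', sub_self] at this
    exact this rfl
  have hle := LinearMap.finrank_le_finrank_of_injective hinj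
  rw [finrank_euclideanSpace_fin, Module.finrank_prod, Module.finrank_self] at hle
  omega

end Form

/-! ## The coordinate swap `(z₁, z₂) ↦ (z₂, z₁)` -/

/-- **The swap of the two complex coordinates** exists as a continuous linear automorphism of
`ℝ⁴`: `S (q₀, q₁, q₂, q₃) = (q₂, q₃, q₀, q₁)`. [folklore] -/
theorem exists_swap : ∃ S : EuclideanSpace ℝ (Fin 4) ≃L[ℝ] EuclideanSpace ℝ (Fin 4),
    ∀ v, S v 0 = v 2 ∧ S v 1 = v 3 ∧ S v 2 = v 0 ∧ S v 3 = v 1 := by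
  set σ : Fin 4 ≃ Fin 4 := (Equiv.swap 0 2).trans (Equiv.swap 1 3) with hσ
  refine ⟨(LinearIsometryEquiv.piLpCongrLeft 2 ℝ ℝ σ).toContinuousLinearEquiv, fun v => ?_⟩
  have h : ∀ i, (LinearIsometryEquiv.piLpCongrLeft 2 ℝ ℝ σ).toContinuousLinearEquiv v i =
      v (σ.symm i) := fun i => by
    simp [LinearIsometryEquiv.piLpCongrLeft_apply, Equiv.piCongrLeft'_apply]
  have e0 : σ.symm 0 = 2 := by decide
  have e1 : σ.symm 1 = 3 := by decide
  have e2 : σ.symm 2 = 0 := by decide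
  have e3 : σ.symm 3 = 1 := by decide
  refine ⟨?_, ?_, ?_, ?_⟩
  · rw [h, e0]
  · rw [h, e1]
  · rw [h, e2]
  · rw [h, e3]

section Swap

variable {S : EuclideanSpace ℝ (Fin 4) ≃L[ℝ] EuclideanSpace ℝ (Fin 4)}
  (hS : ∀ v, S v 0 = v 2 ∧ S v 1 = v 3 ∧ S v 2 = v 0 ∧ S v 3 = v 1)
include hS

/-- The swap is an involution. [folklore] -/
theorem swap_swap (v : EuclideanSpace ℝ (Fin 4)) : S (S v) = v := by
  obtain ⟨h0, h1, h2, h3⟩ := hS (S v)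
  obtain ⟨k0, k1, k2, k3⟩ := hS v
  ext i
  fin_cases i
  · simp only [Fin.zero_eta, Fin.isValue]; rw [h0, k2]
  · simp only [Fin.mk_one, Fin.isValue]; rw [h1, k3]
  · simp only [Fin.reduceFinMk, Fin.isValue]; rw [h2, k0]
  · simp only [Fin.reduceFinMk, Fin.isValue]; rw [h3, k1]

/-- The swap commutes with `I4 = i ⊕ i`. [folklore] -/
theorem swap_I4 (v : EuclideanSpace ℝ (Fin 4)) : S (I4 v) = I4 (S v) := by
  obtain ⟨h0, h1, h2, h3⟩ := hS (I4 v)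
  obtain ⟨k0, k1, k2, k3⟩ := hS v
  ext i
  fin_cases i
  · simp only [Fin.zero_eta, Fin.isValue]; rw [h0, I4_apply0, I4_apply2, k1]
  · simp only [Fin.mk_one, Fin.isValue]; rw [h1, I4_apply1, I4_apply3, k0]
  · simp only [Fin.reduceFinMk, Fin.isValue]; rw [h2, I4_apply2, I4_apply0, k3]
  · simp only [Fin.reduceFinMk, Fin.isValue]; rw [h3, I4_apply3, I4_apply1, k2]

/-- `|z₁|² ∘ S = |z₂|²`. [folklore] -/
theorem r1_swap (v : EuclideanSpace ℝ (Fin 4)) : r1 (S v) = r2 v := by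
  obtain ⟨h0, h1, -, -⟩ := hS v
  rw [r1_def, r2_def, h0, h1]

/-- `|z₂|² ∘ S = |z₁|²`. [folklore] -/
theorem r2_swap (v : EuclideanSpace ℝ (Fin 4)) : r2 (S v) = r1 v := by
  obtain ⟨-, -, h2, h3⟩ := hS v
  rw [r1_def, r2_def, h2, h3]

/-- The swap exchanges the two inversions: `S ∘ inv1 = inv2 ∘ S`. [folklore] -/
theorem swap_inv1 (p : EuclideanSpace ℝ (Fin 4)) : S (inv1 p) = inv2 (S p) := by
  obtain ⟨h0, h1, h2, h3⟩ := hS (inv1 p)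
  obtain ⟨k0, k1, k2, k3⟩ := hS p
  have hr : r2 (S p) = r1 p := r2_swap hS p
  ext i
  fin_cases i
  · simp only [Fin.zero_eta, Fin.isValue]; rw [h0, inv1_apply2, inv2_apply0, k0]
  · simp only [Fin.mk_one, Fin.isValue]; rw [h1, inv1_apply3, inv2_apply1, k1]
  · simp only [Fin.reduceFinMk, Fin.isValue]; rw [h2, inv1_apply0, inv2_apply2, k2, hr]
  · simp only [Fin.reduceFinMk, Fin.isValue]; rw [h3, inv1_apply1, inv2_apply3, k3, hr]

end Swap

end PosHolonomy

/-- **Registered helper sub-goal `helper_positiveHolonomyPlaneKernel`** (first auxiliary file of stub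
`stub_positiveHolonomy`): a linear endomorphism of `ℝ⁴` valued in the axis plane `{p₂ = p₃ = 0}`
kills a non-zero vector. [folklore] -/
theorem helper_positiveHolonomyPlaneKernel :
    ∀ L : EuclideanSpace ℝ (Fin 4) →L[ℝ] EuclideanSpace ℝ (Fin 4),
    (∀ v : EuclideanSpace ℝ (Fin 4), L v 2 = 0 ∧ L v 3 = 0) →
    ∃ v : EuclideanSpace ℝ (Fin 4), v ≠ 0 ∧ L v = 0 :=
  fun _ hL => PosHolonomy.exists_ne_zero_map_eq_zero hL

end Summit.SmoothPoincare4.SmoothPoincare4.Theorems.GromovRecognitionRelEnd.CrossCapLaurent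

end
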